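import Literature.AlgebraicGeometry.Motives.HodgeThetaSubalgebraSymplecticRankSixReduction
import Mathlib.Algebra.Lie.CartanCriterion
import Mathlib.LinearAlgebra.Eigenspace.Triangularizable
import HarnessLib

/-!
# The `Θ`-subalgebra theorem in rank six, PART 2b: the all-nilpotent corner and the dichotomy
# (Moonen–Zarhin 1999 (2.3), Type I(1), `g = 3`)

Family `hodge`, layer `Literature/AlgebraicGeometry/Motives`. Research context: cell `pub-hodge-ring2` (HONEST
FRAMING: research route conditional on HC_CM; not a corollary; Q11.4-sentence-2 already refuted in dim ≥ 3),
Literature lane, programme R13 «generic abelian threefolds», the abstract Lie step, PART 2b. UNCONDITIONAL linear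
algebra over `ℂ`; theorems only, no definition, no named fact (D-0026), no `sorry`. Sequel of PART 1
(`HodgeThetaSubalgebraSymplecticRankSix`) and PART 2a (`HodgeThetaSubalgebraSymplecticRankSixReduction`).

SETTING (as in PARTS 1, 2a). `𝔊 ⊆ End(M)` bracket-closed containing an involution `T` with eigenspaces `P`
(`+1`), `Q` (`−1`); no `𝔊`-stable subspace other than `0`, `M`; `𝔊₊ = {B ∈ 𝔊 : B(P) = 0, B(M) ⊆ P}`, `𝔊₋`
symmetrically, `𝔊₀` the elements preserving `P` and `Q`.

WHAT IS PROVED.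
* §1 `SymplecticThetaSix.false_of_jointKernel` — if `𝔊₊ ≠ 0 ≠ 𝔊₋` then no nonzero `m ∈ P` is killed by all
  products `BC` (`B ∈ 𝔊₊`, `C ∈ 𝔊₋`): the joint kernel in `P` of the products is `𝔊₀`-stable
  (`BC(Zk) = B[C,Z]k + [B,Z]Ck + Z(BCk)`), hence all of `P` by the orbit lemma; then `Σ_C C(P) ⊆ Q` is
  `𝔊₀`-stable, so `0` (and `𝔊₋ = 0`) or `Q` (and `𝔊₊ = 0`) by the orbit lemma for `(Q, P, −T)`.
* §2 `SymplecticThetaSix.false_of_allNilpotent` — THE ALL-NILPOTENT CORNER IS EMPTY: if `𝔊₊ ≠ 0 ≠ 𝔊₋` it is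
  impossible that every product `BC` is nilpotent on `P`. CARTAN'S CRITERION (Mathlib
  `LieModule.isNilpotent_derivedSeries_of_traceForm_eq_zero`): the trace-radical
  `R = {Z ∈ 𝔊 : tr_M(ZY) = 0 ∀ Y ∈ 𝔊}` is a Lie subalgebra containing `𝔊₊` and `𝔊₋` (the products `B Y`,
  `C Y` are traceless block by block, `tr(BC) = 0` being the hypothesis), its trace form on `M` vanishes, so
  `[R, R] ∋ [B, C]` acts nilpotently on `M`; ENGEL (Mathlib `LieModule.nontrivial_max_triv_of_isNilpotent`)
  gives `m ≠ 0` killed by all `[B, C]`, whose `P`- or `Q`-component contradicts §1 (for `(P, Q, T)` or for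
  `(Q, P, −T)`).
* §3 `SymplecticThetaSix.exists_cube_eq_zero_of_eigenvalue` — in dimension three an operator all of whose
  eigenvalues coincide satisfies `(X − t)³ = 0` (generalised eigenspaces, Mathlib
  `Module.End.iSup_maxGenEigenspace_eq_top`); and `SymplecticThetaSix.core_dichotomy` — THE DICHOTOMY: for
  `ω` nondegenerate alternating, `𝔊` bracket-closed `ω`-skew irreducible containing the involution `T` with
  `dim P = 3`, EITHER `𝔊 ⊇ 𝔲⁺ ⊕ 𝔤𝔩(P) ⊕ 𝔲⁻` (so `𝔊 = 𝔰𝔭(M, ω)`), OR `𝔊₊ = ℂB₀`, `𝔊₋ = ℂC₁` for a unit pair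
  `B₀C₁|_P = 1`, `C₁B₀|_Q = 1` (the E³-type skeleton): PART 1 `core_of_twoEigenvalues` if some product has
  two eigenvalues; otherwise §3 gives the single-eigenvalue form, §2 excludes the all-nilpotent corner, and
  PART 2a (`exists_unit_partner`, `lines_of_singleEigenvalue`) gives the skeleton.

NOT here (PART 3): the structure `𝔊₀ = ℂT ⊕ 𝔰𝔬₃` of the skeleton and its arithmetic exclusion under
`End_Hdg(V) = ℚ` (Killing form versus trace form), Theorem L-Sp in rank six, abelian threefolds.

## References

* [MoonenZarhin1999LowDim] B. Moonen, Yu. Zarhin, Hodge classes on abelian varieties of low dimension, Math.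
  Ann. 315 (1999) 711–733 = arXiv:math/9901113, §2 p. 715, (2.3) Type I(1), (2.4) (1), (2.5).
* [Humphreys1972] J. E. Humphreys, Introduction to Lie Algebras and Representation Theory (1972), §3.3
  (Engel), §4.3 (Cartan's criterion), §19.1.
* [Jacobson1962LieAlgebras] N. Jacobson, Lie Algebras (1962), Ch. II §2 Thm. 1, Ch. III §4 (Cartan's criteria).
* [Gordon1997] B. B. Gordon, A survey of the Hodge conjecture for abelian varieties, arXiv:alg-geom/9709030,
  §6 (proof of Thm. 6.3.3).
-/

noncomputable section

namespace Literature.AlgebraicGeometry.Motives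

namespace HodgeStructure

variable {M : Type*} [AddCommGroup M] [Module ℂ M]

/-! ### §1 No common kernel vector for the products `BC` -/

section JointKernel

/-- **No joint kernel.** Let `𝔊` be bracket-closed with the involution `T` (eigenspaces `P`, `Q`), irreducible on
`M`, with `𝔊₊ ≠ 0 ≠ 𝔊₋`. Then no `m ∈ P`, `m ≠ 0`, satisfies `BCm = 0` for all `B ∈ 𝔊₊`, `C ∈ 𝔊₋`. Proof: the
joint kernel `K ⊆ P` of the products is `𝔊₀`-stable (`BC(Zk) = B[C,Z]k + [B,Z]Ck + Z(BCk)`), so `K = P` by the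
orbit lemma (PART 1 `SymplecticThetaSix.eq_bot_or_eq_of_stable_le`); then `W = Σ_C C(P) ⊆ Q` is stable under
the elements of `𝔊` preserving `Q`, hence `W = 0` (so `𝔊₋ = 0`) or `W = Q` (so every `B ∈ 𝔊₊` kills `Q ⊕ P`,
`𝔊₊ = 0`) by the orbit lemma for `(Q, P, −T)`.
[cite: MoonenZarhin1999LowDim, §2 (2.3)] [cite: Gordon1997, §6] -/
theorem SymplecticThetaSix.false_of_jointKernel (𝔊 : Submodule ℂ (Module.End ℂ M))
    (hbr : ∀ Y ∈ 𝔊, ∀ Z ∈ 𝔊, Y * Z - Z * Y ∈ 𝔊) {T : Module.End ℂ M} (hT𝔊 : T ∈ 𝔊) (hTT : ∀ v, T (T v) = v)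
    {P Q : Submodule ℂ M} (hP : ∀ x ∈ P, T x = x) (hQ : ∀ x ∈ Q, T x = -x)
    (hPmem : ∀ v, (2 : ℂ)⁻¹ • (v + T v) ∈ P) (hQmem : ∀ v, (2 : ℂ)⁻¹ • (v - T v) ∈ Q)
    (hirr : ∀ U : Submodule ℂ M, (∀ Z ∈ 𝔊, ∀ u ∈ U, Z u ∈ U) → U = ⊥ ∨ U = ⊤)
    (h𝒮ne : ∃ B ∈ 𝔊, (∀ p ∈ P, B p = 0) ∧ (∀ v, B v ∈ P) ∧ B ≠ 0)
    (h𝒞ne : ∃ C ∈ 𝔊, (∀ q ∈ Q, C q = 0) ∧ (∀ v, C v ∈ Q) ∧ C ≠ 0)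
    {m : M} (hmP : m ∈ P) (hm0 : m ≠ 0)
    (hm : ∀ B ∈ 𝔊, (∀ p ∈ P, B p = 0) → (∀ v, B v ∈ P) → ∀ C ∈ 𝔊, (∀ q ∈ Q, C q = 0) →
      (∀ v, C v ∈ Q) → B (C m) = 0) :
    False := by
  classical
  have hPQv : ∀ v, (2 : ℂ)⁻¹ • (v + T v) + (2 : ℂ)⁻¹ • (v - T v) = v := fun v => by module
  have hPQ0 : ∀ x ∈ P, x ∈ Q → x = 0 := fun x hxP hxQ => by
    have h1 := hP x hxP
    rw [hQ x hxQ, neg_eq_iff_add_eq_zero, ← two_smul ℂ x, smul_eq_zero] at h1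
    exact h1.resolve_left (two_ne_zero' ℂ)
  have hdec := fun Z (hZ : Z ∈ 𝔊) => SymplecticTheta.exists_decomp 𝔊 hbr hT𝔊 hTT hP hQ hPmem hQmem hZ
  -- mirrored configuration `(Q, P, -T)`
  have hnT𝔊 : -T ∈ 𝔊 := Submodule.neg_mem _ hT𝔊
  have hnTT : ∀ v, (-T) ((-T) v) = v := fun v => by
    rw [LinearMap.neg_apply, LinearMap.neg_apply, map_neg, neg_neg, hTT]
  have hP' : ∀ x ∈ Q, (-T) x = x := fun x hx => by rw [LinearMap.neg_apply, hQ x hx, neg_neg]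
  have hQ' : ∀ x ∈ P, (-T) x = -x := fun x hx => by rw [LinearMap.neg_apply, hP x hx]
  have hPmem' : ∀ v, (2 : ℂ)⁻¹ • (v + (-T) v) ∈ Q := fun v => by
    rw [LinearMap.neg_apply, ← sub_eq_add_neg]; exact hQmem v
  have hQmem' : ∀ v, (2 : ℂ)⁻¹ • (v - (-T) v) ∈ P := fun v => by
    rw [LinearMap.neg_apply, sub_neg_eq_add]; exact hPmem v
  -- the joint kernel `K ⊆ P`
  set K : Submodule ℂ M := P ⊓ ⨅ (B : Module.End ℂ M)
    (_ : B ∈ 𝔊 ∧ (∀ p ∈ P, B p = 0) ∧ ∀ v, B v ∈ P) (C : Module.End ℂ M)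
    (_ : C ∈ 𝔊 ∧ (∀ q ∈ Q, C q = 0) ∧ ∀ v, C v ∈ Q), LinearMap.ker (B * C) with hK
  have hmemK : ∀ v, v ∈ K ↔ v ∈ P ∧ ∀ B : Module.End ℂ M, (B ∈ 𝔊 ∧ (∀ p ∈ P, B p = 0) ∧ ∀ v, B v ∈ P) →
      ∀ C : Module.End ℂ M, (C ∈ 𝔊 ∧ (∀ q ∈ Q, C q = 0) ∧ ∀ v, C v ∈ Q) → B (C v) = 0 := fun v => by
    simp only [hK, Submodule.mem_inf, Submodule.mem_iInf, LinearMap.mem_ker, Module.End.mul_apply]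
  have hKP : K ≤ P := inf_le_left
  have hKstab : ∀ Z ∈ 𝔊, (∀ p ∈ P, Z p ∈ P) → ∀ k ∈ K, Z k ∈ K := by
    intro Z hZ hZP k hk
    obtain ⟨hkP, hkK⟩ := (hmemK k).1 hk
    obtain ⟨Zm, -, Z0, hZ0, Zp, -, hZeq, hZpP, -, -, hZmim, -, -, hZ0P, hZ0Q⟩ := hdec Z hZ
    have hZk : Z k = Z0 k := by
      have h1 : Z k = Zm k + Z0 k := by
        rw [hZeq, LinearMap.add_apply, LinearMap.add_apply, hZpP k hkP, add_zero]
      have hZmk : Zm k = 0 := hPQ0 _ (by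
        have h2 : Zm k = Z k - Z0 k := by rw [h1]; abel
        rw [h2]
        exact sub_mem (hZP k hkP) (hZ0P k hkP)) (hZmim k)
      rw [h1, hZmk, zero_add]
    rw [hZk, hmemK]
    refine ⟨hZ0P k hkP, fun B hB C hC => ?_⟩
    have hC' : (C * Z0 - Z0 * C) ∈ 𝔊 ∧ (∀ q ∈ Q, (C * Z0 - Z0 * C) q = 0) ∧ ∀ v, (C * Z0 - Z0 * C) v ∈ Q :=
      ⟨hbr C hC.1 Z0 hZ0, fun q hq => by
        rw [LinearMap.sub_apply, Module.End.mul_apply, Module.End.mul_apply, hC.2.1 _ (hZ0Q q hq), hC.2.1 q hq,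
          map_zero, sub_zero], fun v => sub_mem (hC.2.2 _) (hZ0Q _ (hC.2.2 v))⟩
    have hB' : (B * Z0 - Z0 * B) ∈ 𝔊 ∧ (∀ p ∈ P, (B * Z0 - Z0 * B) p = 0) ∧ ∀ v, (B * Z0 - Z0 * B) v ∈ P :=
      ⟨hbr B hB.1 Z0 hZ0, fun p hp => by
        rw [LinearMap.sub_apply, Module.End.mul_apply, Module.End.mul_apply, hB.2.1 _ (hZ0P p hp), hB.2.1 p hp,
          map_zero, sub_zero], fun v => sub_mem (hB.2.2 _) (hZ0P _ (hB.2.2 v))⟩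
    have e : B (C (Z0 k)) = B ((C * Z0 - Z0 * C) k) + (B * Z0 - Z0 * B) (C k) + Z0 (B (C k)) := by
      simp only [LinearMap.sub_apply, Module.End.mul_apply, map_sub]
      abel
    rw [e, hkK B hB _ hC', hkK _ hB' C hC, hkK B hB C hC, map_zero, add_zero, add_zero]
  -- `K = P`
  have hKeq : K = P := by
    rcases SymplecticThetaSix.eq_bot_or_eq_of_stable_le 𝔊 hbr hT𝔊 hTT hP hQ hPmem hQmem hirr K hKP hKstab with
      h | h
    · exfalso
      apply hm0
      have hmK : m ∈ K := (hmemK m).2 ⟨hmP, fun B hB C hC => hm B hB.1 hB.2.1 hB.2.2 C hC.1 hC.2.1 hC.2.2⟩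
      rw [h, Submodule.mem_bot] at hmK
      exact hmK
    · exact h
  have hall : ∀ B : Module.End ℂ M, (B ∈ 𝔊 ∧ (∀ p ∈ P, B p = 0) ∧ ∀ v, B v ∈ P) →
      ∀ C : Module.End ℂ M, (C ∈ 𝔊 ∧ (∀ q ∈ Q, C q = 0) ∧ ∀ v, C v ∈ Q) → ∀ p ∈ P, B (C p) = 0 :=
    fun B hB C hC p hp => ((hmemK p).1 (hKeq ▸ hp)).2 B hB C hC
  -- the orbit `W = Σ_C C(P) ⊆ Q`
  set S : Set M := {x | ∃ C : Module.End ℂ M, (C ∈ 𝔊 ∧ (∀ q ∈ Q, C q = 0) ∧ ∀ v, C v ∈ Q) ∧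
    ∃ p ∈ P, x = C p} with hS
  set W : Submodule ℂ M := Submodule.span ℂ S with hW
  have hWQ : W ≤ Q := by
    rw [hW, Submodule.span_le]
    rintro _ ⟨C, hC, p, -, rfl⟩
    exact hC.2.2 p
  have hWof : ∀ C : Module.End ℂ M, (C ∈ 𝔊 ∧ (∀ q ∈ Q, C q = 0) ∧ ∀ v, C v ∈ Q) → ∀ p ∈ P, C p ∈ W :=
    fun C hC p hp => Submodule.subset_span ⟨C, hC, p, hp, rfl⟩
  have hWstab : ∀ Z ∈ 𝔊, (∀ q ∈ Q, Z q ∈ Q) → ∀ x ∈ W, Z x ∈ W := by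
    intro Z hZ hZQ x hx
    obtain ⟨Zm, -, Z0, hZ0, Zp, -, hZeq, -, hZpim, hZmQ, -, -, -, hZ0P, hZ0Q⟩ := hdec Z hZ
    induction hx using Submodule.span_induction with
    | mem x hx =>
      obtain ⟨C, hC, p, hp, rfl⟩ := hx
      -- `Z(Cp) = Z0(Cp) = [Z0, C]p + C(Z0 p)`
      have hCpQ : C p ∈ Q := hC.2.2 p
      have h1 : Z (C p) = Z0 (C p) + Zp (C p) := by
        rw [hZeq, LinearMap.add_apply, LinearMap.add_apply, hZmQ _ hCpQ, zero_add]
      have hZp0 : Zp (C p) = 0 := hPQ0 _ (hZpim _) (by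
        have h2 : Zp (C p) = Z (C p) - Z0 (C p) := by rw [h1]; abel
        rw [h2]
        exact sub_mem (hZQ _ hCpQ) (hZ0Q _ hCpQ))
      rw [h1, hZp0, add_zero]
      have hC' : (Z0 * C - C * Z0) ∈ 𝔊 ∧ (∀ q ∈ Q, (Z0 * C - C * Z0) q = 0) ∧
          ∀ v, (Z0 * C - C * Z0) v ∈ Q :=
        ⟨hbr Z0 hZ0 C hC.1, fun q hq => by
          rw [LinearMap.sub_apply, Module.End.mul_apply, Module.End.mul_apply, hC.2.1 q hq, map_zero,
            hC.2.1 _ (hZ0Q q hq), sub_zero], fun v => sub_mem (hZ0Q _ (hC.2.2 v)) (hC.2.2 _)⟩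
      have e : Z0 (C p) = (Z0 * C - C * Z0) p + C (Z0 p) := by
        simp only [LinearMap.sub_apply, Module.End.mul_apply]
        abel
      rw [e]
      exact add_mem (hWof _ hC' p hp) (hWof C hC _ (hZ0P p hp))
    | zero => rw [map_zero]; exact zero_mem _
    | add x y _ _ hx hy => rw [map_add]; exact add_mem hx hy
    | smul a x _ hx => rw [map_smul]; exact Submodule.smul_mem _ a hx
  obtain ⟨B₁, hB₁𝔊, hB₁P, hB₁im, hB₁0⟩ := h𝒮ne
  obtain ⟨C₁, hC₁𝔊, hC₁Q, hC₁im, hC₁0⟩ := h𝒞ne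
  rcases SymplecticThetaSix.eq_bot_or_eq_of_stable_le 𝔊 hbr hnT𝔊 hnTT hP' hQ' hPmem' hQmem' hirr W hWQ hWstab
    with h | h
  · -- `W = 0`: `𝔊₋ = 0`
    apply hC₁0
    ext v
    rw [← hPQv v, map_add, hC₁Q _ (hQmem v), add_zero, LinearMap.zero_apply]
    have hx := hWof C₁ ⟨hC₁𝔊, hC₁Q, hC₁im⟩ _ (hPmem v)
    rw [h, Submodule.mem_bot] at hx
    exact hx
  · -- `W = Q`: `𝔊₊ = 0`
    apply hB₁0
    have hBW : ∀ x ∈ W, B₁ x = 0 := by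
      intro x hx
      induction hx using Submodule.span_induction with
      | mem x hx =>
        obtain ⟨C, hC, p, hp, rfl⟩ := hx
        exact hall B₁ ⟨hB₁𝔊, hB₁P, hB₁im⟩ C hC p hp
      | zero => rw [map_zero]
      | add x y _ _ hx hy => rw [map_add, hx, hy, add_zero]
      | smul a x _ hx => rw [map_smul, hx, smul_zero]
    ext v
    rw [← hPQv v, map_add, hB₁P _ (hPmem v), zero_add, LinearMap.zero_apply]
    exact hBW _ (h.symm ▸ hQmem v)

end JointKernel

/-! ### §2 The all-nilpotent corner is empty (Cartan's criterion and Engel's theorem) -/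

section AllNilpotent

/-- **The all-nilpotent corner is empty.** Let `𝔊 ⊆ End(M)` be bracket-closed with the involution `T`
(eigenspaces `P`, `Q`), irreducible on `M`, with `𝔊₊ ≠ 0 ≠ 𝔊₋`. Then NOT every product `BC` (`B ∈ 𝔊₊`,
`C ∈ 𝔊₋`) is nilpotent on `P`. Proof: the trace-radical `R = {Z ∈ 𝔊 : tr_M(ZY) = 0 for all Y ∈ 𝔊}` is a Lie
subalgebra of `End(M)` (invariance of the trace form) containing `𝔊₊` and `𝔊₋` (block by block; `tr(BC) = 0` is
the hypothesis) whose trace form on `M` vanishes; by CARTAN'S CRITERION `[R, R]` acts nilpotently on `M`, by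
ENGEL'S THEOREM some `m ≠ 0` is killed by `[R, R] ∋ [B, C]`; the components `m_P`, `m_Q` are then killed by
all `BC`, resp. `CB`, contradicting §1 for `(P, Q, T)` or for `(Q, P, −T)`.
[cite: Humphreys1972, §4.3 (Cartan's criterion), §3.3 (Engel)] [cite: Jacobson1962LieAlgebras, Ch. III §4]
[cite: MoonenZarhin1999LowDim, §2 (2.3)] -/
theorem SymplecticThetaSix.false_of_allNilpotent [FiniteDimensional ℂ M] (𝔊 : Submodule ℂ (Module.End ℂ M))
    (hbr : ∀ Y ∈ 𝔊, ∀ Z ∈ 𝔊, Y * Z - Z * Y ∈ 𝔊) {T : Module.End ℂ M} (hT𝔊 : T ∈ 𝔊) (hTT : ∀ v, T (T v) = v)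
    {P Q : Submodule ℂ M} (hP : ∀ x ∈ P, T x = x) (hQ : ∀ x ∈ Q, T x = -x)
    (hPmem : ∀ v, (2 : ℂ)⁻¹ • (v + T v) ∈ P) (hQmem : ∀ v, (2 : ℂ)⁻¹ • (v - T v) ∈ Q)
    (hirr : ∀ U : Submodule ℂ M, (∀ Z ∈ 𝔊, ∀ u ∈ U, Z u ∈ U) → U = ⊥ ∨ U = ⊤)
    (h𝒮ne : ∃ B ∈ 𝔊, (∀ p ∈ P, B p = 0) ∧ (∀ v, B v ∈ P) ∧ B ≠ 0)
    (h𝒞ne : ∃ C ∈ 𝔊, (∀ q ∈ Q, C q = 0) ∧ (∀ v, C v ∈ Q) ∧ C ≠ 0)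
    (hnil : ∀ B ∈ 𝔊, (∀ p ∈ P, B p = 0) → (∀ v, B v ∈ P) → ∀ C ∈ 𝔊, (∀ q ∈ Q, C q = 0) →
      (∀ v, C v ∈ Q) → ∀ p ∈ P, ((B * C) ^ 3 : Module.End ℂ M) p = 0) :
    False := by
  classical
  -- the commutator bracket on `End(M)` (Mathlib keeps `LieRing.ofAssociativeRing` a local instance)
  letI : LieRing (Module.End ℂ M) := LieRing.ofAssociativeRing
  have hPQv : ∀ v, (2 : ℂ)⁻¹ • (v + T v) + (2 : ℂ)⁻¹ • (v - T v) = v := fun v => by module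
  have hPQ0 : ∀ x ∈ P, x ∈ Q → x = 0 := fun x hxP hxQ => by
    have h1 := hP x hxP
    rw [hQ x hxQ, neg_eq_iff_add_eq_zero, ← two_smul ℂ x, smul_eq_zero] at h1
    exact h1.resolve_left (two_ne_zero' ℂ)
  have hdec := fun Z (hZ : Z ∈ 𝔊) => SymplecticTheta.exists_decomp 𝔊 hbr hT𝔊 hTT hP hQ hPmem hQmem hZ
  -- mirrored configuration `(Q, P, -T)`
  have hnT𝔊 : -T ∈ 𝔊 := Submodule.neg_mem _ hT𝔊
  have hnTT : ∀ v, (-T) ((-T) v) = v := fun v => by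
    rw [LinearMap.neg_apply, LinearMap.neg_apply, map_neg, neg_neg, hTT]
  have hP' : ∀ x ∈ Q, (-T) x = x := fun x hx => by rw [LinearMap.neg_apply, hQ x hx, neg_neg]
  have hQ' : ∀ x ∈ P, (-T) x = -x := fun x hx => by rw [LinearMap.neg_apply, hP x hx]
  have hPmem' : ∀ v, (2 : ℂ)⁻¹ • (v + (-T) v) ∈ Q := fun v => by
    rw [LinearMap.neg_apply, ← sub_eq_add_neg]; exact hQmem v
  have hQmem' : ∀ v, (2 : ℂ)⁻¹ • (v - (-T) v) ∈ P := fun v => by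
    rw [LinearMap.neg_apply, sub_neg_eq_add]; exact hPmem v
  -- traces of cube-zero operators vanish
  have htr0 : ∀ N : Module.End ℂ M, N * N * N = 0 → LinearMap.trace ℂ M N = 0 := fun N hN =>
    (LinearMap.isNilpotent_trace_of_isNilpotent ⟨3, by rw [pow_three', hN]⟩).eq_zero
  -- `tr(B Y) = 0` and `tr(C Y) = 0` for `B ∈ 𝔊₊`, `C ∈ 𝔊₋`, `Y ∈ 𝔊`
  have htrBC : ∀ B ∈ 𝔊, (∀ p ∈ P, B p = 0) → (∀ v, B v ∈ P) → ∀ C ∈ 𝔊, (∀ q ∈ Q, C q = 0) →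
      (∀ v, C v ∈ Q) → LinearMap.trace ℂ M (B * C) = 0 := by
    intro B hB hBP hBim C hC hCQ hCim
    apply htr0
    ext v
    rw [← hPQv v]
    have h3 := hnil B hB hBP hBim C hC hCQ hCim _ (hPmem v)
    rw [pow_three'] at h3
    rw [map_add, h3, zero_add, LinearMap.zero_apply]
    simp only [Module.End.mul_apply, hCQ _ (hQmem v), map_zero]
  have htrB0 : ∀ B : Module.End ℂ M, (∀ p ∈ P, B p = 0) → ∀ Y : Module.End ℂ M, (∀ p ∈ P, Y p ∈ P) →
      (∀ v, (B * Y) v ∈ P) → LinearMap.trace ℂ M (B * Y) = 0 := by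
    intro B hBP Y hYP hBYim
    apply htr0
    ext v
    rw [Module.End.mul_apply, Module.End.mul_apply, LinearMap.zero_apply]
    have h1 : (B * Y) ((B * Y) v) = 0 := by
      rw [Module.End.mul_apply]; exact hBP _ (hYP _ (hBYim v))
    rw [h1, map_zero]
  have htrB : ∀ B ∈ 𝔊, (∀ p ∈ P, B p = 0) → (∀ v, B v ∈ P) → ∀ Y ∈ 𝔊, LinearMap.trace ℂ M (B * Y) = 0 := by
    intro B hB hBP hBim Y hY
    obtain ⟨Ym, hYm, Y0, -, Yp, -, hYeq, hYpP, hYpim, hYmQ, hYmim, -, -, hY0P, -⟩ := hdec Y hY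
    have hBYp : B * Yp = 0 := by ext v; exact hBP _ (hYpim v)
    rw [hYeq, mul_add, mul_add, map_add, map_add, htrBC B hB hBP hBim Ym hYm hYmQ hYmim,
      htrB0 B hBP Y0 hY0P (fun v => hBim _), hBYp, map_zero, add_zero, add_zero]
  have htrC : ∀ C ∈ 𝔊, (∀ q ∈ Q, C q = 0) → (∀ v, C v ∈ Q) → ∀ Y ∈ 𝔊, LinearMap.trace ℂ M (C * Y) = 0 := by
    intro C hC hCQ hCim Y hY
    obtain ⟨Ym, -, Y0, -, Yp, hYp, hYeq, hYpP, hYpim, hYmQ, hYmim, -, -, -, hY0Q⟩ := hdec Y hY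
    have hCYm : C * Ym = 0 := by ext v; exact hCQ _ (hYmim v)
    have hCY0 : LinearMap.trace ℂ M (C * Y0) = 0 := by
      apply htr0
      ext v
      rw [Module.End.mul_apply, Module.End.mul_apply, LinearMap.zero_apply]
      have h1 : (C * Y0) ((C * Y0) v) = 0 := by
        rw [Module.End.mul_apply, Module.End.mul_apply]; exact hCQ _ (hY0Q _ (hCim _))
      rw [h1, map_zero]
    rw [hYeq, mul_add, mul_add, map_add, map_add, hCYm, map_zero, zero_add, hCY0, zero_add,
      LinearMap.trace_mul_comm ℂ C Yp]
    exact htrBC Yp hYp hYpP hYpim C hC hCQ hCim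
  -- the trace radical `R`, a Lie subalgebra of `End(M)` with vanishing trace form
  set Rsub : Submodule ℂ (Module.End ℂ M) := 𝔊 ⊓ ⨅ (Y : Module.End ℂ M) (_ : Y ∈ 𝔊),
    LinearMap.ker ((LinearMap.trace ℂ M).comp (LinearMap.mulRight ℂ Y)) with hRsub
  have hmemR : ∀ Z, Z ∈ Rsub ↔ Z ∈ 𝔊 ∧ ∀ Y ∈ 𝔊, LinearMap.trace ℂ M (Z * Y) = 0 := fun Z => by
    simp only [hRsub, Submodule.mem_inf, Submodule.mem_iInf, LinearMap.mem_ker, LinearMap.comp_apply,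
      LinearMap.mulRight_apply]
  let R : LieSubalgebra ℂ (Module.End ℂ M) :=
    { Rsub with
      lie_mem' := by
        intro Z Z' hZ hZ'
        change Z ∈ Rsub at hZ
        change Z' ∈ Rsub at hZ'
        change ⁅Z, Z'⁆ ∈ Rsub
        rw [hmemR] at hZ hZ' ⊢
        refine ⟨by rw [Ring.lie_def]; exact hbr Z hZ.1 Z' hZ'.1, fun Y hY => ?_⟩
        rw [Ring.lie_def, sub_mul, map_sub, mul_assoc, mul_assoc, LinearMap.trace_mul_comm ℂ Z' (Z * Y),
          mul_assoc, ← map_sub, ← mul_sub]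
        exact hZ.2 _ (hbr Z' hZ'.1 Y hY) }
  have hmemRL : ∀ Z, Z ∈ R ↔ Z ∈ 𝔊 ∧ ∀ Y ∈ 𝔊, LinearMap.trace ℂ M (Z * Y) = 0 := fun Z => hmemR Z
  have htoEnd : ∀ z : R, LieModule.toEnd ℂ R M z = (z : Module.End ℂ M) := fun z => by
    ext m
    simp [LieSubalgebra.coe_bracket_of_module]
  have htf : LieModule.traceForm ℂ R M = 0 := by
    refine LinearMap.ext fun z => LinearMap.ext fun z' => ?_
    rw [LieModule.traceForm_apply_apply, htoEnd, htoEnd, LinearMap.zero_apply, LinearMap.zero_apply]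
    exact ((hmemRL _).1 z.2).2 _ ((hmemRL _).1 z'.2).1
  -- Cartan's criterion and Engel's theorem
  have hnilp : LieModule.IsNilpotent (LieAlgebra.derivedSeries ℂ R 1) M :=
    LieModule.isNilpotent_derivedSeries_of_traceForm_eq_zero htf
  obtain ⟨B₁, hB₁𝔊, hB₁P, hB₁im, hB₁0⟩ := h𝒮ne
  have hMnt : Nontrivial M := by
    by_contra h
    rw [not_nontrivial_iff_subsingleton] at h
    exact hB₁0 (Subsingleton.elim _ _)
  haveI := hnilp
  haveI := LieModule.nontrivial_max_triv_of_isNilpotent ℂ (↥(LieAlgebra.derivedSeries ℂ R 1)) M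
  obtain ⟨x, hx0⟩ := exists_ne (0 : ↥(LieModule.maxTrivSubmodule ℂ (↥(LieAlgebra.derivedSeries ℂ R 1)) M))
  set m : M := (x : M) with hmdef
  have hm0' : m ≠ 0 := fun h => hx0 (Subtype.ext h)
  have hmtriv := (LieModule.mem_maxTrivSubmodule ℂ (↥(LieAlgebra.derivedSeries ℂ R 1)) M m).1 x.2
  -- every `[B, C]` kills `m`
  have hkill : ∀ B ∈ 𝔊, (∀ p ∈ P, B p = 0) → (∀ v, B v ∈ P) → ∀ C ∈ 𝔊, (∀ q ∈ Q, C q = 0) →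
      (∀ v, C v ∈ Q) → B (C m) - C (B m) = 0 := by
    intro B hB hBP hBim C hC hCQ hCim
    have hBR : B ∈ R := (hmemRL B).2 ⟨hB, htrB B hB hBP hBim⟩
    have hCR : C ∈ R := (hmemRL C).2 ⟨hC, htrC C hC hCQ hCim⟩
    have hbc : ⁅(⟨B, hBR⟩ : R), (⟨C, hCR⟩ : R)⁆ ∈ LieAlgebra.derivedSeries ℂ R 1 := by
      rw [LieAlgebra.derivedSeries_def, LieAlgebra.derivedSeriesOfIdeal_succ,
        LieAlgebra.derivedSeriesOfIdeal_zero]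
      exact LieSubmodule.lie_mem_lie (LieSubmodule.mem_top _) (LieSubmodule.mem_top _)
    have h := hmtriv ⟨_, hbc⟩
    simpa [LieSubalgebra.coe_bracket_of_module, Ring.lie_def] using h
  -- components of `m`
  set mP := (2 : ℂ)⁻¹ • (m + T m) with hmP
  set mQ := (2 : ℂ)⁻¹ • (m - T m) with hmQ
  have hmPP : mP ∈ P := hPmem m
  have hmQQ : mQ ∈ Q := hQmem m
  have hmeq : mP + mQ = m := hPQv m
  have hboth : ∀ B ∈ 𝔊, (∀ p ∈ P, B p = 0) → (∀ v, B v ∈ P) → ∀ C ∈ 𝔊, (∀ q ∈ Q, C q = 0) →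
      (∀ v, C v ∈ Q) → B (C mP) = 0 ∧ C (B mQ) = 0 := by
    intro B hB hBP hBim C hC hCQ hCim
    have h := hkill B hB hBP hBim C hC hCQ hCim
    rw [← hmeq, map_add C, hCQ _ hmQQ, add_zero, map_add B, hBP _ hmPP, zero_add, sub_eq_zero] at h
    have h0 : B (C mP) = 0 := hPQ0 _ (hBim _) (h ▸ hCim _)
    exact ⟨h0, by rw [← h, h0]⟩
  by_cases hmP0 : mP = 0
  · have hmQ0 : mQ ≠ 0 := fun h => hm0' (by rw [← hmeq, hmP0, h, add_zero])
    exact SymplecticThetaSix.false_of_jointKernel 𝔊 hbr hnT𝔊 hnTT hP' hQ' hPmem' hQmem' hirr h𝒞ne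
      ⟨B₁, hB₁𝔊, hB₁P, hB₁im, hB₁0⟩ hmQQ hmQ0
      (fun C hC hCQ hCim B hB hBP hBim => (hboth B hB hBP hBim C hC hCQ hCim).2)
  · exact SymplecticThetaSix.false_of_jointKernel 𝔊 hbr hT𝔊 hTT hP hQ hPmem hQmem hirr
      ⟨B₁, hB₁𝔊, hB₁P, hB₁im, hB₁0⟩ h𝒞ne hmPP hmP0
      (fun B hB hBP hBim C hC hCQ hCim => (hboth B hB hBP hBim C hC hCQ hCim).1)

end AllNilpotent

/-! ### §3 The single-eigenvalue form and the dichotomy -/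

section Dichotomy

/-- **Single eigenvalue in dimension three.** If all eigenvalues of `X` on a `3`-dimensional complex space
coincide, then `(X − t)³ = 0` for some `t`: `X` has an eigenvalue `t` (algebraic closure), every generalised
eigenspace for `μ ≠ t` vanishes (it would contain an eigenvector), the generalised eigenspaces span, and the
one for `t` is `ker (X − t)³` (`dim = 3`). (Mathlib: `Module.End.iSup_maxGenEigenspace_eq_top`.)
[cite: Humphreys1972, §4.2] [cite: GoodmanWallachGTM255, §B.1] -/
theorem SymplecticThetaSix.exists_cube_eq_zero_of_eigenvalue {W : Type*} [AddCommGroup W] [Module ℂ W]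
    [FiniteDimensional ℂ W] (hW : Module.finrank ℂ W = 3) (X : Module.End ℂ W)
    (hone : ∀ μ₁ μ₂ : ℂ, ∀ v₁ v₂ : W, v₁ ≠ 0 → X v₁ = μ₁ • v₁ → v₂ ≠ 0 → X v₂ = μ₂ • v₂ → μ₁ = μ₂) :
    ∃ t : ℂ, (X - t • 1) ^ 3 = 0 := by
  classical
  haveI : Nontrivial W := Module.nontrivial_of_finrank_pos (R := ℂ) (by rw [hW]; norm_num)
  obtain ⟨t, ht⟩ := Module.End.exists_eigenvalue X
  obtain ⟨v₀, hv₀⟩ := ht.exists_hasEigenvector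
  refine ⟨t, ?_⟩
  have hbot : ∀ μ, μ ≠ t → X.maxGenEigenspace μ = ⊥ := by
    intro μ hμ
    by_contra hne
    have hμev : X.HasEigenvalue μ :=
      (Module.End.hasUnifEigenvalue_iff_hasUnifEigenvalue_one (by simp)).1 hne
    obtain ⟨w, hw⟩ := hμev.exists_hasEigenvector
    exact hμ (hone μ t w v₀ hw.2 hw.apply_eq_smul hv₀.2 hv₀.apply_eq_smul)
  ext x
  have hx : x ∈ ⨆ μ, X.maxGenEigenspace μ := by
    rw [Module.End.iSup_maxGenEigenspace_eq_top]; exact Submodule.mem_top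
  have hle : (⨆ μ, X.maxGenEigenspace μ) ≤ X.maxGenEigenspace t := iSup_le fun μ => by
    by_cases h : μ = t
    · rw [h]
    · rw [hbot μ h]; exact bot_le
  have hx' : x ∈ X.maxGenEigenspace t := hle hx
  have h3 := Module.End.genEigenspace_le_genEigenspace_finrank X t ⊤ hx'
  rw [hW, Module.End.mem_genEigenspace_nat, LinearMap.mem_ker] at h3
  rw [LinearMap.zero_apply]
  exact h3

/-- **The dichotomy (rank six).** Let `ω` be nondegenerate alternating on `M`, `𝔊 ⊆ End(M)` bracket-closed and
`ω`-skew containing an involution `T ∈ 𝔊` with eigenspaces `P` (`+1`, `dim P = 3`) and `Q` (`−1`), and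
suppose `M` has no `𝔊`-stable subspace other than `0`, `M`. Then EITHER `𝔊` contains `𝔲⁺`, the Levi
`𝔤𝔩(P)` and `𝔲⁻` (so `𝔊 = 𝔰𝔭(M, ω)`), OR `𝔊₊ = ℂB₀` and `𝔊₋ = ℂC₁` for a unit pair `B₀ ∈ 𝔊₊`, `C₁ ∈ 𝔊₋`
(`B₀C₁|_P = 1`, `C₁B₀|_Q = 1`) — the E³-type skeleton `𝔰𝔩₂ ⊗ 1 ⊕ 1 ⊗ 𝔰` of Moonen–Zarhin (2.5). Proof: if some
product `BC|_P` (`B ∈ 𝔊₊`, `C ∈ 𝔊₋`) has two eigenvalues, PART 1 `core_of_twoEigenvalues`; otherwise every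
product satisfies `(BC − t)³ = 0` on `P` (`exists_cube_eq_zero_of_eigenvalue`); `𝔊₊ ≠ 0 ≠ 𝔊₋` (else `Q` or
`P` is stable); if some `t ≠ 0`, PART 2a (`exists_unit_partner`, `lines_of_singleEigenvalue`); if all
`t = 0`, §2 (`false_of_allNilpotent`) is contradicted.
[cite: MoonenZarhin1999LowDim, §2 (2.3), (2.5)] [cite: Gordon1997, §6] [cite: GoodmanWallachGTM255, §2.1.2] -/
theorem SymplecticThetaSix.core_dichotomy [FiniteDimensional ℂ M] (ω : LinearMap.BilinForm ℂ M)
    (hωnd : ω.Nondegenerate) (hωalt : ∀ x y, ω x y = -ω y x) (𝔊 : Submodule ℂ (Module.End ℂ M))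
    (hbr : ∀ Y ∈ 𝔊, ∀ Z ∈ 𝔊, Y * Z - Z * Y ∈ 𝔊) (hskew : ∀ Z ∈ 𝔊, ∀ x y, ω (Z x) y + ω x (Z y) = 0)
    {T : Module.End ℂ M} (hT𝔊 : T ∈ 𝔊) (hTT : ∀ v, T (T v) = v) {P Q : Submodule ℂ M}
    (hP : ∀ x ∈ P, T x = x) (hQ : ∀ x ∈ Q, T x = -x) (hPmem : ∀ v, (2 : ℂ)⁻¹ • (v + T v) ∈ P)
    (hQmem : ∀ v, (2 : ℂ)⁻¹ • (v - T v) ∈ Q)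
    (hirr : ∀ U : Submodule ℂ M, (∀ Z ∈ 𝔊, ∀ u ∈ U, Z u ∈ U) → U = ⊥ ∨ U = ⊤)
    (hP3 : Module.finrank ℂ ↥P = 3) :
    ((∀ Y : Module.End ℂ M, (∀ x y, ω (Y x) y + ω x (Y y) = 0) → (∀ p ∈ P, Y p = 0) → (∀ v, Y v ∈ P) →
        Y ∈ 𝔊) ∧
      (∀ Y : Module.End ℂ M, (∀ x y, ω (Y x) y + ω x (Y y) = 0) → (∀ p ∈ P, Y p ∈ P) →
        (∀ q ∈ Q, Y q ∈ Q) → Y ∈ 𝔊) ∧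
      (∀ Y : Module.End ℂ M, (∀ x y, ω (Y x) y + ω x (Y y) = 0) → (∀ q ∈ Q, Y q = 0) → (∀ v, Y v ∈ Q) →
        Y ∈ 𝔊)) ∨
    (∃ B₀ ∈ 𝔊, ∃ C₁ ∈ 𝔊, (∀ p ∈ P, B₀ p = 0) ∧ (∀ v, B₀ v ∈ P) ∧ (∀ q ∈ Q, C₁ q = 0) ∧ (∀ v, C₁ v ∈ Q) ∧
      (∀ p ∈ P, B₀ (C₁ p) = p) ∧ (∀ q ∈ Q, C₁ (B₀ q) = q) ∧
      (∀ B ∈ 𝔊, (∀ p ∈ P, B p = 0) → (∀ v, B v ∈ P) → ∃ c : ℂ, B = c • B₀) ∧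
      (∀ C ∈ 𝔊, (∀ q ∈ Q, C q = 0) → (∀ v, C v ∈ Q) → ∃ c : ℂ, C = c • C₁)) := by
  classical
  by_cases h1 : ∃ B ∈ 𝔊, (∀ p ∈ P, B p = 0) ∧ (∀ v, B v ∈ P) ∧ ∃ C ∈ 𝔊, ∃ μ₁ μ₂ : ℂ, ∃ v₁ v₂ : M,
      μ₁ ≠ μ₂ ∧ v₁ ∈ P ∧ v₁ ≠ 0 ∧ B (C v₁) = μ₁ • v₁ ∧ v₂ ∈ P ∧ v₂ ≠ 0 ∧ B (C v₂) = μ₂ • v₂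
  · obtain ⟨B, hB, hBP, hBim, C, hC, μ₁, μ₂, v₁, v₂, hne, hv₁P, hv₁, h1v, hv₂P, hv₂, h2v⟩ := h1
    exact Or.inl (SymplecticThetaSix.core_of_twoEigenvalues ω hωnd hωalt 𝔊 hbr hskew hT𝔊 hTT hP hQ hPmem
      hQmem hirr hP3 hB hBP hBim hC hne hv₁P hv₁ h1v hv₂P hv₂ h2v)
  -- basic facts
  have hPQv : ∀ v, (2 : ℂ)⁻¹ • (v + T v) + (2 : ℂ)⁻¹ • (v - T v) = v := fun v => by module
  have hPQ0 : ∀ x ∈ P, x ∈ Q → x = 0 := fun x hxP hxQ => by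
    have h := hP x hxP
    rw [hQ x hxQ, neg_eq_iff_add_eq_zero, ← two_smul ℂ x, smul_eq_zero] at h
    exact h.resolve_left (two_ne_zero' ℂ)
  have hPiso : ∀ x ∈ P, ∀ y ∈ P, ω x y = 0 := fun x hx y hy => by
    have h := hskew T hT𝔊 x y
    rw [hP x hx, hP y hy] at h
    exact add_self_eq_zero.1 h
  have hdec := fun Z (hZ : Z ∈ 𝔊) => SymplecticTheta.exists_decomp 𝔊 hbr hT𝔊 hTT hP hQ hPmem hQmem hZ
  -- every product has a single eigenvalue on `P`
  have hsingle : ∀ B ∈ 𝔊, (∀ p ∈ P, B p = 0) → (∀ v, B v ∈ P) → ∀ C ∈ 𝔊, (∀ q ∈ Q, C q = 0) →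
      (∀ v, C v ∈ Q) → ∃ t : ℂ, ∀ p ∈ P, ((B * C - t • 1) ^ 3 : Module.End ℂ M) p = 0 := by
    intro B hB hBP hBim C hC _ _
    have hXP : ∀ x ∈ P, (B * C) x ∈ P := fun x _ => hBim _
    set Xr := (B * C).restrict hXP with hXr
    have hXrcoe : ∀ y : ↥P, ((Xr y : ↥P) : M) = B (C y) := fun y => by
      rw [hXr, LinearMap.coe_restrict_apply, Module.End.mul_apply]
    obtain ⟨t, ht3⟩ := SymplecticThetaSix.exists_cube_eq_zero_of_eigenvalue hP3 Xr (by
      intro μ₁ μ₂ w₁ w₂ hw₁ h1w hw₂ h2w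
      by_contra hne
      apply h1
      refine ⟨B, hB, hBP, hBim, C, hC, μ₁, μ₂, w₁, w₂, hne, w₁.2, fun h => hw₁ (Subtype.ext h), ?_, w₂.2,
        fun h => hw₂ (Subtype.ext h), ?_⟩
      · rw [← hXrcoe, h1w, Submodule.coe_smul]
      · rw [← hXrcoe, h2w, Submodule.coe_smul])
    refine ⟨t, fun p hp => ?_⟩
    have hcoe : ∀ y : ↥P, (((Xr - t • 1) y : ↥P) : M) = (B * C - t • 1) (y : M) := fun y => by
      rw [LinearMap.sub_apply, LinearMap.smul_apply, Module.End.one_apply, Submodule.coe_sub, Submodule.coe_smul,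
        hXrcoe, LinearMap.sub_apply, LinearMap.smul_apply, Module.End.one_apply, Module.End.mul_apply]
    have h := congrArg Subtype.val (LinearMap.congr_fun ht3 ⟨p, hp⟩)
    rw [pow_three, Module.End.mul_apply, Module.End.mul_apply, hcoe, hcoe, hcoe, LinearMap.zero_apply,
      Submodule.coe_zero] at h
    rw [pow_three, Module.End.mul_apply, Module.End.mul_apply]
    exact h
  -- `𝔊₊ ≠ 0 ≠ 𝔊₋`
  have hPne : P ≠ ⊥ := fun h => by
    rw [h, finrank_bot] at hP3
    exact absurd hP3 (by norm_num)
  have hQne : Q ≠ ⊥ := fun hQbot => hPne (by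
    rw [eq_bot_iff]
    intro x hx
    rw [Submodule.mem_bot]
    have hallP : ∀ v : M, v ∈ P := fun v => by
      have hq : (2 : ℂ)⁻¹ • (v - T v) = 0 := by
        have h := hQmem v
        rwa [hQbot, Submodule.mem_bot] at h
      rw [← hPQv v, hq, add_zero]
      exact hPmem v
    exact hωnd.1 x fun y => hPiso x hx y (hallP y))
  have h𝒮ne : ∃ B ∈ 𝔊, (∀ p ∈ P, B p = 0) ∧ (∀ v, B v ∈ P) ∧ B ≠ 0 := by
    by_contra hcon
    push Not at hcon
    have hQstab : ∀ Z ∈ 𝔊, ∀ q ∈ Q, Z q ∈ Q := by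
      intro Z hZ q hq
      obtain ⟨Zm', hZm', Z0', -, Zp', hZp', hZeq', hZpP', hZpim', hZmQ', -, -, -, -, hZ0Q'⟩ := hdec Z hZ
      rw [hZeq', LinearMap.add_apply, LinearMap.add_apply, hZmQ' q hq, zero_add, hcon Zp' hZp' hZpP' hZpim',
        LinearMap.zero_apply, add_zero]
      exact hZ0Q' q hq
    rcases hirr Q hQstab with h | h
    · exact hQne h
    · exact hPne (by
        rw [eq_bot_iff]
        intro x hx
        rw [Submodule.mem_bot]
        exact hPQ0 x hx (h ▸ Submodule.mem_top))
  have h𝒞ne : ∃ C ∈ 𝔊, (∀ q ∈ Q, C q = 0) ∧ (∀ v, C v ∈ Q) ∧ C ≠ 0 := by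
    by_contra hcon
    push Not at hcon
    have hPstab : ∀ Z ∈ 𝔊, ∀ p ∈ P, Z p ∈ P := by
      intro Z hZ p hp
      obtain ⟨Zm', hZm', Z0', -, Zp', -, hZeq', -, hZpim', hZmQ', hZmim', -, -, hZ0P'', -⟩ := hdec Z hZ
      rw [hZeq', LinearMap.add_apply, LinearMap.add_apply, hcon Zm' hZm' hZmQ' hZmim', LinearMap.zero_apply,
        zero_add]
      exact Submodule.add_mem _ (hZ0P'' p hp) (hZpim' p)
    rcases hirr P hPstab with h | h
    · exact hPne h
    · exact hQne (by
        rw [eq_bot_iff]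
        intro x hx
        rw [Submodule.mem_bot]
        exact hPQ0 x (h ▸ Submodule.mem_top) hx)
  by_cases h2 : ∃ B ∈ 𝔊, (∀ p ∈ P, B p = 0) ∧ (∀ v, B v ∈ P) ∧ ∃ C ∈ 𝔊, (∀ q ∈ Q, C q = 0) ∧
      (∀ v, C v ∈ Q) ∧ ∃ t : ℂ, t ≠ 0 ∧ ∀ p ∈ P, ((B * C - t • 1) ^ 3 : Module.End ℂ M) p = 0
  · obtain ⟨B₀, hB₀, hB₀P, hB₀im, C, hC, hCQ, hCim, t, ht, hN⟩ := h2
    obtain ⟨C₁, hC₁, hC₁Q, hC₁im, hBC, hCB⟩ := SymplecticThetaSix.exists_unit_partner ω hωnd 𝔊 hbr hskew hT𝔊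
      hQ hPmem hQmem hB₀ hC hCQ hCim ht hN
    obtain ⟨hS, hCc⟩ := SymplecticThetaSix.lines_of_singleEigenvalue 𝔊 hbr hT𝔊 hTT hP hQ hPmem hQmem hirr hP3
      hsingle hB₀ hB₀P hB₀im hC₁ hC₁Q hC₁im hBC hCB
    exact Or.inr ⟨B₀, hB₀, C₁, hC₁, hB₀P, hB₀im, hC₁Q, hC₁im, hBC, hCB,
      fun B hB hBP hBim => ⟨_, hS B hB hBP hBim⟩, fun C hC hCQ hCim => ⟨_, hCc C hC hCQ hCim⟩⟩
  · exfalso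
    refine SymplecticThetaSix.false_of_allNilpotent 𝔊 hbr hT𝔊 hTT hP hQ hPmem hQmem hirr h𝒮ne h𝒞ne ?_
    intro B hB hBP hBim C hC hCQ hCim p hp
    obtain ⟨t, ht⟩ := hsingle B hB hBP hBim C hC hCQ hCim
    by_cases ht0 : t = 0
    · rw [ht0, zero_smul, sub_zero] at ht
      exact ht p hp
    · exact absurd ⟨B, hB, hBP, hBim, C, hC, hCQ, hCim, t, ht0, ht⟩ h2

end Dichotomy

end HodgeStructure

end Literature.AlgebraicGeometry.Motives
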